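import Summits.MatrixMultiplication.OmegaCensus.DominoZpZpStructSeven
import Summits.MatrixMultiplication.OmegaCensus.DominoZ11StructSevenData
import HarnessLib

/-!
# Decides over the excluded list of the structural part-`7` route, `p = 11` (chunked)

ω-census `pub-omega`, family (b3), seat pub-omega-group gen 24.  Framing: lottery ticket; floor = certified bounds/negative
ranges.  VALUE: per-prime kernel data of the STRUCTURAL part-`7` route (`DominoZpZpStructSeven*.lean`) for `p = 11` —
target: the OPEN census cells `(1,7,23)@484` ×2 (`A = ℤ₄ × ℤ₁₁²`, `ℤ₂² × ℤ₁₁²`) and every larger order; NOT progress on ω.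

`checkE1seven` (entries ≤ 3) and `checkEwf7` (well-formedness) over the whole list; `checkR7` (every excluded key scales into the 76
representatives) and `checkE2gt` (closure under the primitive root 2, tree form) decided PER LITERAL CHUNK of `eZ11s7` (3 chunks; one kernel decide
must stay small — the unchunked `checkR7` over 760 keys exhausts the kernel) and assembled with the `*_append` lemmas of
`DominoZpZpStructSeven.lean`.
-/

namespace Summit.MatrixMultiplication.OmegaCensus

open ZpZpDomino

namespace ZpZpDomino

/-- Entries of excluded keys are `≤ 3`. [folklore] -/
theorem checkE1seven_11 : checkE1seven eZ11s7 = true := by decide +kernel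

/-- The excluded list is well formed (lengths `11`, digits `< 8`). [folklore] -/
theorem checkEwf7_11 : checkEwf7 11 eZ11s7 = true := by decide +kernel

set_option maxHeartbeats 4000000 in
/-- Scaling into the representatives, chunk 1. [folklore] -/
theorem checkR7_11_1 : checkR7 11 eZ11s7_1 rZ11s7 = true := by decide +kernel
set_option maxHeartbeats 4000000 in
/-- Closure under the primitive root (tree form), chunk 1. [folklore] -/
theorem checkE2gt7_11_1 : checkE2gt 11 2 eZ11s7_1 etZ11s7 = true := by decide +kernel

set_option maxHeartbeats 4000000 in
/-- Scaling into the representatives, chunk 2. [folklore] -/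
theorem checkR7_11_2 : checkR7 11 eZ11s7_2 rZ11s7 = true := by decide +kernel
set_option maxHeartbeats 4000000 in
/-- Closure under the primitive root (tree form), chunk 2. [folklore] -/
theorem checkE2gt7_11_2 : checkE2gt 11 2 eZ11s7_2 etZ11s7 = true := by decide +kernel

set_option maxHeartbeats 4000000 in
/-- Scaling into the representatives, chunk 3. [folklore] -/
theorem checkR7_11_3 : checkR7 11 eZ11s7_3 rZ11s7 = true := by decide +kernel
set_option maxHeartbeats 4000000 in
/-- Closure under the primitive root (tree form), chunk 3. [folklore] -/
theorem checkE2gt7_11_3 : checkE2gt 11 2 eZ11s7_3 etZ11s7 = true := by decide +kernel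

/-- Assembled over the 3 chunks. [folklore] -/
theorem checkR7_11 : checkR7 11 eZ11s7 rZ11s7 = true := by
  rw [eZ11s7]
  exact checkR7_append (checkR7_append checkR7_11_1 checkR7_11_2) checkR7_11_3

/-- Assembled over the 3 chunks. [folklore] -/
theorem checkE2gt7_11 : checkE2gt 11 2 eZ11s7 etZ11s7 = true := by
  rw [eZ11s7]
  exact checkE2gt_append (checkE2gt_append checkE2gt7_11_1 checkE2gt7_11_2) checkE2gt7_11_3

end ZpZpDomino

end Summit.MatrixMultiplication.OmegaCensus
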